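/-
Copyright (c) 2026 the pub-hodgecm-mathlib formalisation cell (harness21).  Prover seat hodgecm-mathlib-K2E4-p11 (g4), Track B ∕ K2-LIT, h413 =
`stmt-HodgeConjecture-24833`, line `K2_E1_TraceFormulaBeta`, campaign «EIS-RANK-ONE», rung R6h ∕ [D5]₃ E-LAYER, deal (E-d) of K2E1-plan (g4) 2026-09-04T07:22:26Z ∕ 07:44:09Z:
THE E-LAYER ARCHIMEDEAN BINDER `hφarchZ` OF ★ p858259 `poleControl_sphericalEisenstein_cm_three_of_archSmooth` DISCHARGED — the centre-averaged spherical section of `U(2,1)`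
over a CM field is `C^m` in the archimedean Heisenberg shift with derivatives dominated by the centre average of `C_φ·H^{Re z′}`, ONE `C_φ` for all `‖z′‖ ≤ R`.
-/
import Summits.HodgeConjecture.HodgeConjecture.Theorems.K2E1CentreAverageScalingU3     -- ★ (E-c) p858434 (this seat): the hypothesis-free idele scaling of the centre averages
import Summits.HodgeConjecture.HodgeConjecture.Theorems.K2E1QuadraticNormPowSymbol      -- ★ (E-b) p858458 (this seat): `‖Dⁿ[(1+½‖x‖²)^{1−2z}]‖ ≤ C·(1+½‖x‖²)^{1−2Re z}` on `‖z‖ ≤ R`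
import Summits.HodgeConjecture.HodgeConjecture.Theorems.K2E1HeightLineArchSmoothU3       -- ★ (a3)₃ p858136 (K2E1-p08 (g5)): `norm_iteratedFDeriv_finset_prod_le_explicit`; brings ★ `K2E1TensorSymbolProduct`, ★ (a3)₂
import HarnessLib

/-!
# h413 ∕ Track B «K2-LIT», «EIS-RANK-ONE» [D5]₃ (E-d) — `K2E1HeightLineArchSmoothU3E`: the binder `hφarchZ` of ★ p858259, PROVED
# (`∀ R, ∃ C_φ ≥ 0, ∀ ‖z′‖ ≤ R, ∀ k ∈ K_U, ∀ B`: `s ↦ (μ_F D_F)⁻¹·∫ f_{z′}(ι(w₀)·u((ι⁻¹s, B), θt)·k) dμ_F(t)` is `C^m` on `mixedSpace L` with `‖Dʲ‖ ≤ ∫ C_φ·H(…(ι⁻¹s, B)…)^{Re z′} dμ_F`)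

Cell `pub/hodgecm-mathlib`, crux H413 = `stmt-HodgeConjecture-24833`, route `HCCMUnconditional`; dealer K2E1-plan (g4), deal (E-d) 07:22:26Z, instruction 07:44:09Z (both sides
Bochner-junk together: NO integrability anywhere), REPORT-FIRST 07:45Z («=» 07:45:20Z).  THEOREMS ONLY (no `def`, no `instance`, no `notation`, no named-fact hypothesis, no
`sorry`); lane `--kind proof --supports stmt-HodgeConjecture-24833 --as helper` (count-neutral).
THE PROOF (route (IV) «SCALING»).  By ★ (E-c) `integral_flatSectionU_const_centre_eq_prod_cpow_mul_cm_three` the function is, on `mixedSpace L = (∅ → ℝ) × (∏_{w complex} ℂ)`,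
`s ↦ c_D · I₀(z′,B,k) · ∏_w q(s_w)^{1−2z′}` with `q(x) = 1 + ½‖x‖²`, `c_D = (μ_F D_F)⁻¹`, `I₀ = ∫ f_{z′}(ι(w₀)·u((0,B), θt)·k) dμ_F` INDEPENDENT of `s`; each factor is the one-place
symbol of ★ (E-b) pulled back along the coordinate form `ℓ_w = proj_w ∘ snd` (`‖ℓ_w‖ ≤ 1`, ★ `norm_iteratedFDeriv_comp_clm_le`), so ★ (a3)₃ `norm_iteratedFDeriv_finset_prod_le_explicit`
gives `C^m` and `‖Dʲ‖ ≤ ‖c_D‖·‖I₀‖·(2^m C_max)^{#w}·∏_w q(s_w)^{1−2Re z′}`; `‖I₀‖ ≤ ‖φ₀‖·J₀`, `J₀ = ∫ H(ι(w₀)·u((0,B),θt)·k)^{Re z′} dμ_F ≥ 0` (`norm_integral_le_integral_norm`,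
unconditional), and the right-hand side `∫ C_φ·H(…(ι⁻¹s,B)…)^{Re z′} dμ_F = ∏_w q(s_w)^{1−2Re z′} · C_φ · J₀` by the real twin of ★ (E-c); `C_φ := ‖c_D‖·‖φ₀‖·(2^m C_max)^{#w}` does not
see `z′, k, B`.
* §1 plumbing on `mixedSpace` of a CM field: `‖(ι⁻¹ s)_w‖ = ‖s_w‖` at a complex place, `‖proj_w ∘ snd‖ ≤ 1`, `‖∫ f_z‖ ≤ ‖φ₀‖·∫ H^{Re z}`.
* §2 HEAD **`exists_archSmoothZ_flatSectionU_const_cm_three_uniform (hc hcδ hδ) (μF) (φ₀ m R)`** — the bytes of `hφarchZ R` of ★ p858259 ∕ ★ U3b p858228 §2 at `φ ≡ φ₀`.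
HONEST LABEL.  Count-neutral helper; proves no printed statement; closes no socket by itself (ED. 3 of ★ p858259 plugs it); HC_CM is proved only modulo the 7 printed
citations (2 remaining named inputs: hLiu418 = `stmt-HodgeConjecture-24832`, h413 = `stmt-HodgeConjecture-24833`) until rung 0 closes.

## References
* [MoeglinWaldspurger1995] C. Mœglin, J.-L. Waldspurger, *Spectral decomposition and Eisenstein series* (1995), I.2.10–I.2.12, II.1.5–II.1.7.
* [HormanderALPDO1] L. Hörmander, *The Analysis of Linear Partial Differential Operators I* (1983), §7.1.
* [Garrett2018] P. Garrett, *Modern Analysis of Automorphic Forms by Example* 1 (2018), §2.2, §2.8, §12.2.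
-/

set_option autoImplicit false
set_option linter.dupNamespace false  -- the mandated namespace repeats the summit's segment (`HodgeConjecture.HodgeConjecture`)

noncomputable section

open MeasureTheory Measure NumberField NumberField.InfinitePlace NumberField.mixedEmbedding IsDedekindDomain
open Literature.NumberTheory.Automorphic Literature.NumberTheory.Automorphic.UnitaryGroup AdelicGroupData
open Summit.HodgeConjecture.HodgeConjecture.Cruxes.H413.K2E1BorelEisensteinU (flatSectionU flatSectionU_apply)
open Summit.HodgeConjecture.HodgeConjecture.Cruxes.H413.K2E1CentreAverageScalingU3
open Summit.HodgeConjecture.HodgeConjecture.Cruxes.H413.K2E1QuadraticNormPowSymbol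
open Summit.HodgeConjecture.HodgeConjecture.Cruxes.H413.K2E1HeightLineArchSmoothU3 (norm_iteratedFDeriv_finset_prod_le_explicit)
open Summit.HodgeConjecture.HodgeConjecture.Cruxes.H413.K2E1HeightLineArchSmoothU2 (ofReal_prod_cpow_of_nonneg)
open Summit.HodgeConjecture.HodgeConjecture.Cruxes.H413.K2E1TensorSymbolProduct (norm_iteratedFDeriv_comp_clm_le)
-- `Classical` is needed to see the Mathlib normed-space instances on `mixedSpace` (note H5 of `AdelicGLnGlue`)
open scoped NNReal ContDiff Classical

namespace Summit.HodgeConjecture.HodgeConjecture.Cruxes.H413.K2E1HeightLineArchSmoothU3E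

/-! ## §1 Plumbing: complex coordinates of the mixed space, the coordinate forms, the norm of a centre integral -/

section Plumbing

/-- **`‖(ι⁻¹ s)_w‖ = ‖s_w‖` at a complex place `w`**: the complex coordinate of Mathlib's `ringEquiv_mixedSpace` is the isometry `extensionEmbedding w`. [folklore] -/
theorem norm_ringEquiv_mixedSpace_symm_apply_of_isComplex (K : Type) [Field K] [NumberField K] (s : mixedSpace K) (w : InfinitePlace K) (hw : w.IsComplex) :
    ‖(InfiniteAdeleRing.ringEquiv_mixedSpace K).symm s w‖ = ‖s.2 ⟨w, hw⟩‖ := by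
  conv_rhs => rw [← (InfiniteAdeleRing.ringEquiv_mixedSpace K).apply_symm_apply s]
  rw [InfiniteAdeleRing.ringEquiv_mixedSpace_apply]
  exact ((AddMonoidHomClass.isometry_iff_norm _).1 (NumberField.InfinitePlace.Completion.isometry_extensionEmbedding w) _).symm

/-- `‖proj_v ∘ snd‖ ≤ 1` on the mixed space (sup norms). [folklore] -/
theorem norm_proj_comp_snd_le_one (K : Type) [Field K] [NumberField K] (v : {v : InfinitePlace K // v.IsComplex}) :
    ‖(ContinuousLinearMap.proj (R := ℝ) (φ := fun _ : {v : InfinitePlace K // v.IsComplex} => ℂ) v).comp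
        (ContinuousLinearMap.snd ℝ ({v : InfinitePlace K // v.IsReal} → ℝ) ({v : InfinitePlace K // v.IsComplex} → ℂ))‖ ≤ 1 := by
  refine ContinuousLinearMap.opNorm_le_bound _ zero_le_one fun s => ?_
  rw [one_mul]
  exact (norm_le_pi_norm s.2 v).trans (norm_snd_le s)

/-- **`‖∫ f_z(h(t)) dμ‖ ≤ ‖φ₀‖ · ∫ H(h(t))^{Re z} dμ`** for the flat section `f_z = φ₀·H^z` at a constant `φ₀` along ANY family `h` — UNCONDITIONAL (`norm_integral_le_integral_norm`;
`‖H^z‖ = H^{Re z}` as `H > 0`). [cite: MoeglinWaldspurger1995, II.1.5] -/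
theorem norm_integral_flatSectionU_const_le {F E : Type} [Field F] [NumberField F] [Field E] [NumberField E] [Algebra F E] {c : E ≃ₐ[F] E} {N : ℕ} [NeZero N]
    {α : Type*} [MeasurableSpace α] (μ : Measure α) (φ₀ z : ℂ) (h : α → (quasiSplit F E c N).Adelic) :
    ‖∫ t, flatSectionU (fun _ : (quasiSplit F E c N).Adelic => φ₀) z (h t) ∂μ‖ ≤ ‖φ₀‖ * ∫ t, ((borelHeight (h t) : ℝ)) ^ z.re ∂μ := by
  refine (norm_integral_le_integral_norm _).trans (le_of_eq ?_)
  rw [← integral_const_mul]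
  refine integral_congr_ae (Filter.Eventually.of_forall fun t => ?_)
  show ‖flatSectionU (fun _ : (quasiSplit F E c N).Adelic => φ₀) z (h t)‖ = ‖φ₀‖ * ((borelHeight (h t) : ℝ)) ^ z.re
  rw [flatSectionU_apply, norm_mul, Complex.norm_cpow_eq_rpow_re_of_pos (NNReal.coe_pos.2 (borelHeight_pos (h t)))]

end Plumbing

/-! ## §2 The E-layer binder `hφarchZ`, ONE `C_φ` for all `‖z′‖ ≤ R` -/

section ArchSmoothZ

variable (L : Type) [Field L] [NumberField L] [IsCMField L]

/-- **(E-d) «E-LAYER ARCH» — THE ARCHIMEDEAN BINDER `hφarchZ` OF ★ p858259 `poleControl_sphericalEisenstein_cm_three_of_archSmooth`, PROVED.**  For a CM field `L` (`c² = 1`,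
`δ ∈ L⁻ ∖ 0`), an additive Haar measure `μ_F` on `𝔸_{L⁺}`, `φ₀ ∈ ℂ`, `m ∈ ℕ`, `R ∈ ℝ` there is ONE `C_φ ≥ 0` such that for EVERY `z′` with `‖z′‖ ≤ R`, every `k ∈ K_U` and every finite
shift `B ∈ 𝔸_L^∞` the centre-averaged spherical section `a ↦ (μ_F D_F)⁻¹·∫ f_{z′}(ι(w₀)·u((a,B), θt)·k) dμ_F(t)`, read on `mixedSpace L` through `ι⁻¹`, is `C^m` and
`‖Dʲ(…)(s)‖ ≤ ∫ C_φ·H(ι(w₀)·u((ι⁻¹s, B), θt)·k)^{Re z′} dμ_F(t)` (`j ≤ m`).  Route (IV) «SCALING»: ★ (E-c) closed form `c_D·I₀·∏_w q(s_w)^{1−2z′}`, ★ (E-b) one-place symbol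
bounds (uniform on `‖z′‖ ≤ R`), ★ (a3)₃ tensor Leibniz with the explicit constant `(2^m C_max)^{#w}`, `‖I₀‖ ≤ ‖φ₀‖·J₀` unconditionally, and the real twin of ★ (E-c) for the
right-hand side; `C_φ = ‖c_D‖·‖φ₀‖·(2^m C_max)^{#w}`.  No integrability is used: in the divergent regime both sides are Bochner junk together.
[cite: MoeglinWaldspurger1995, I.2.10–I.2.12, II.1.5–II.1.7] [cite: HormanderALPDO1, §7.1] [cite: Garrett2018, §2.2, §12.2] -/
theorem exists_archSmoothZ_flatSectionU_const_cm_three_uniform (hc : IsCMField.complexConj L * IsCMField.complexConj L = 1) {δ : L} (hcδ : IsCMField.complexConj L δ = -δ) (hδ : δ ≠ 0)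
    [MeasurableSpace (AdeleRing (𝓞 ↥(maximalRealSubfield L)) ↥(maximalRealSubfield L))] [BorelSpace (AdeleRing (𝓞 ↥(maximalRealSubfield L)) ↥(maximalRealSubfield L))] (μF : Measure (AdeleRing (𝓞 ↥(maximalRealSubfield L)) ↥(maximalRealSubfield L))) [μF.IsAddHaarMeasure] (φ₀ : ℂ) (m : ℕ) (R : ℝ) :
    ∃ Cφ : ℝ, 0 ≤ Cφ ∧ ∀ z' : ℂ, ‖z'‖ ≤ R → ∀ k ∈ ((standardMaximalCompactGL 3 L).comap (adelicVal ↥(maximalRealSubfield L) L (IsCMField.complexConj L) 3 ((StdForm.antidiagonal 3).over L)) : Subgroup (quasiSplit (↥(maximalRealSubfield L)) L (IsCMField.complexConj L) 3).Adelic), ∀ B : FiniteAdeleRing (𝓞 L) L,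
      ContDiff ℝ m ((fun a : InfiniteAdeleRing L => ((μF (adeleFundamentalDomain ↥(maximalRealSubfield L))).toReal⁻¹ : ℂ) *
          ∫ t, flatSectionU (fun _ : (quasiSplit (↥(maximalRealSubfield L)) L (IsCMField.complexConj L) 3).Adelic => φ₀) z' (((quasiSplit (↥(maximalRealSubfield L)) L (IsCMField.complexConj L) 3).toAdelic (weylLongU ((IsCMField.complexConj L : L ≃ₐ[↥(maximalRealSubfield L)] L) : L →+* L) (rfl : ((StdForm.antidiagonal 3).over L) = ((StdForm.antidiagonal 3).over L)))) *
            ((heisChart hc (((a, B) : AdeleRing (𝓞 L) L), traceZeroLine ↥(maximalRealSubfield L) L (IsCMField.complexConj L) hcδ hδ t) : ↥(adelicUnipotent ↥(maximalRealSubfield L) L (IsCMField.complexConj L) 3)) : (quasiSplit (↥(maximalRealSubfield L)) L (IsCMField.complexConj L) 3).Adelic) * k) ∂μF) ∘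
        (InfiniteAdeleRing.ringEquiv_mixedSpace L).symm) ∧
      ∀ j : ℕ, j ≤ m → ∀ s : mixedSpace L,
        ‖iteratedFDeriv ℝ j ((fun a : InfiniteAdeleRing L => ((μF (adeleFundamentalDomain ↥(maximalRealSubfield L))).toReal⁻¹ : ℂ) *
          ∫ t, flatSectionU (fun _ : (quasiSplit (↥(maximalRealSubfield L)) L (IsCMField.complexConj L) 3).Adelic => φ₀) z' (((quasiSplit (↥(maximalRealSubfield L)) L (IsCMField.complexConj L) 3).toAdelic (weylLongU ((IsCMField.complexConj L : L ≃ₐ[↥(maximalRealSubfield L)] L) : L →+* L) (rfl : ((StdForm.antidiagonal 3).over L) = ((StdForm.antidiagonal 3).over L)))) *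
            ((heisChart hc (((a, B) : AdeleRing (𝓞 L) L), traceZeroLine ↥(maximalRealSubfield L) L (IsCMField.complexConj L) hcδ hδ t) : ↥(adelicUnipotent ↥(maximalRealSubfield L) L (IsCMField.complexConj L) 3)) : (quasiSplit (↥(maximalRealSubfield L)) L (IsCMField.complexConj L) 3).Adelic) * k) ∂μF) ∘
          (InfiniteAdeleRing.ringEquiv_mixedSpace L).symm) s‖ ≤
          ∫ t, Cφ * ((borelHeight (((quasiSplit (↥(maximalRealSubfield L)) L (IsCMField.complexConj L) 3).toAdelic (weylLongU ((IsCMField.complexConj L : L ≃ₐ[↥(maximalRealSubfield L)] L) : L →+* L) (rfl : ((StdForm.antidiagonal 3).over L) = ((StdForm.antidiagonal 3).over L)))) *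
            ((heisChart hc (((((InfiniteAdeleRing.ringEquiv_mixedSpace L).symm s), B) : AdeleRing (𝓞 L) L), traceZeroLine ↥(maximalRealSubfield L) L (IsCMField.complexConj L) hcδ hδ t) : ↥(adelicUnipotent ↥(maximalRealSubfield L) L (IsCMField.complexConj L) 3)) :
              (quasiSplit (↥(maximalRealSubfield L)) L (IsCMField.complexConj L) 3).Adelic) * k) : ℝ)) ^ z'.re ∂μF := by
  -- (0) data independent of `z′, k, B`: all places of `L` are complex; the coordinate forms `ℓ_w = proj_w ∘ snd`; the one-place constants of ★ (E-b)
  have hcw : ∀ w : InfinitePlace L, w.IsComplex := fun w => IsTotallyComplex.isComplex w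
  set ℓ : InfinitePlace L → (mixedSpace L →L[ℝ] ℂ) := fun w =>
    (ContinuousLinearMap.proj (R := ℝ) (φ := fun _ : {v : InfinitePlace L // v.IsComplex} => ℂ) ⟨w, hcw w⟩).comp
      (ContinuousLinearMap.snd ℝ ({v : InfinitePlace L // v.IsReal} → ℝ) ({v : InfinitePlace L // v.IsComplex} → ℂ)) with hℓ_def
  have hℓ : ∀ w, ‖ℓ w‖ ≤ 1 := fun w => norm_proj_comp_snd_le_one L ⟨w, hcw w⟩
  have hℓs : ∀ (w : InfinitePlace L) (s : mixedSpace L), ℓ w s = s.2 ⟨w, hcw w⟩ := fun w s => rfl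
  choose C hC0 hC using fun j : ℕ => exists_norm_iteratedFDeriv_quad_cpow_one_sub_two_mul_le_uniform (F := ℂ) R j
  set Cmax : ℝ := ∑ j ∈ Finset.range (m + 1), C j with hCmax_def
  have hCmax0 : 0 ≤ Cmax := Finset.sum_nonneg fun j _ => hC0 j
  have hCle : ∀ j ≤ m, C j ≤ Cmax := fun j hj =>
    Finset.single_le_sum (f := fun j => C j) (fun i _ => hC0 i) (Finset.mem_range.2 (Nat.lt_succ_of_le hj))
  refine ⟨‖((μF (adeleFundamentalDomain ↥(maximalRealSubfield L))).toReal⁻¹ : ℂ)‖ * ‖φ₀‖ * (2 ^ m * Cmax) ^ (Finset.univ : Finset (InfinitePlace L)).card, by positivity, fun z' hz' k hk B => ?_⟩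
  -- (1) the factors `g_w = q^{1−2z′} ∘ ℓ_w` and their envelopes `e_w = q(ℓ_w s)^{1−2Re z′}`
  set g : InfinitePlace L → mixedSpace L → ℂ := fun w => (fun x : ℂ => (((1 + ‖x‖ ^ 2 / 2 : ℝ)) : ℂ) ^ (1 - 2 * z')) ∘ ℓ w with hg_def
  have hg : ∀ w ∈ (Finset.univ : Finset (InfinitePlace L)), ContDiff ℝ (m : ℕ∞) (g w) := fun w _ =>
    (contDiff_quad_cpow_one_sub_two_mul (F := ℂ) z').comp (ℓ w).contDiff
  set e : InfinitePlace L → mixedSpace L → ℝ := fun w s => (1 + ‖ℓ w s‖ ^ 2 / 2) ^ (1 - 2 * z'.re) with he_def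
  have he : ∀ w ∈ (Finset.univ : Finset (InfinitePlace L)), ∀ s, 0 ≤ e w s := fun w _ s => Real.rpow_nonneg (quad_pos (ℓ w s)).le _
  have hb : ∀ w ∈ (Finset.univ : Finset (InfinitePlace L)), ∀ j ≤ m, ∀ s, ‖iteratedFDeriv ℝ j (g w) s‖ ≤ Cmax * e w s := by
    intro w _ j hj s
    have hjm : (j : WithTop ℕ∞) ≤ ((⊤ : ℕ∞) : WithTop ℕ∞) := by exact_mod_cast le_top
    calc ‖iteratedFDeriv ℝ j (g w) s‖ ≤ ‖ℓ w‖ ^ j * ‖iteratedFDeriv ℝ j (fun x : ℂ => (((1 + ‖x‖ ^ 2 / 2 : ℝ)) : ℂ) ^ (1 - 2 * z')) (ℓ w s)‖ :=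
          norm_iteratedFDeriv_comp_clm_le (contDiff_quad_cpow_one_sub_two_mul (F := ℂ) z' (n := ((⊤ : ℕ∞) : WithTop ℕ∞))) (ℓ w) s hjm
      _ ≤ 1 * (C j * (1 + ‖ℓ w s‖ ^ 2 / 2) ^ (1 - 2 * z'.re)) :=
          mul_le_mul (pow_le_one₀ (norm_nonneg _) (hℓ w)) (hC j z' hz' (ℓ w s)) (norm_nonneg _) zero_le_one
      _ ≤ Cmax * e w s := by
          rw [one_mul]
          exact mul_le_mul_of_nonneg_right (hCle j hj) (he w (Finset.mem_univ w) s)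
  -- (2) the tensor Leibniz rule with the explicit constant `(2^m C_max)^{#w}`
  obtain ⟨hprod, hbound⟩ := norm_iteratedFDeriv_finset_prod_le_explicit (Finset.univ : Finset (InfinitePlace L)) hg (le_refl _) hCmax0 he hb
  -- (3) the closed form: `Φ ∘ ι⁻¹ = (c_D · I₀) • ∏_w g_w` (★ (E-c))
  have hP : ∀ s : mixedSpace L, (∏ w : InfinitePlace L, (1 + ‖((InfiniteAdeleRing.ringEquiv_mixedSpace L).symm s) w‖ ^ 2 / 2)) = (∏ w : InfinitePlace L, (1 + ‖ℓ w s‖ ^ 2 / 2)) := fun s =>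
    Finset.prod_congr rfl fun w _ => by rw [hℓs, norm_ringEquiv_mixedSpace_symm_apply_of_isComplex L s w (hcw w)]
  have hfun : ((fun a : InfiniteAdeleRing L => ((μF (adeleFundamentalDomain ↥(maximalRealSubfield L))).toReal⁻¹ : ℂ) *
          ∫ t, flatSectionU (fun _ : (quasiSplit (↥(maximalRealSubfield L)) L (IsCMField.complexConj L) 3).Adelic => φ₀) z' (((quasiSplit (↥(maximalRealSubfield L)) L (IsCMField.complexConj L) 3).toAdelic (weylLongU ((IsCMField.complexConj L : L ≃ₐ[↥(maximalRealSubfield L)] L) : L →+* L) (rfl : ((StdForm.antidiagonal 3).over L) = ((StdForm.antidiagonal 3).over L)))) *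
            ((heisChart hc (((a, B) : AdeleRing (𝓞 L) L), traceZeroLine ↥(maximalRealSubfield L) L (IsCMField.complexConj L) hcδ hδ t) : ↥(adelicUnipotent ↥(maximalRealSubfield L) L (IsCMField.complexConj L) 3)) : (quasiSplit (↥(maximalRealSubfield L)) L (IsCMField.complexConj L) 3).Adelic) * k) ∂μF) ∘
        (InfiniteAdeleRing.ringEquiv_mixedSpace L).symm) = (((μF (adeleFundamentalDomain ↥(maximalRealSubfield L))).toReal⁻¹ : ℂ) * (∫ t, flatSectionU (fun _ : (quasiSplit (↥(maximalRealSubfield L)) L (IsCMField.complexConj L) 3).Adelic => φ₀) z' (((quasiSplit (↥(maximalRealSubfield L)) L (IsCMField.complexConj L) 3).toAdelic (weylLongU ((IsCMField.complexConj L : L ≃ₐ[↥(maximalRealSubfield L)] L) : L →+* L) (rfl : ((StdForm.antidiagonal 3).over L) = ((StdForm.antidiagonal 3).over L)))) * ((heisChart hc ((((0 : InfiniteAdeleRing L), B) : AdeleRing (𝓞 L) L), traceZeroLine ↥(maximalRealSubfield L) L (IsCMField.complexConj L) hcδ hδ t) : ↥(adelicUnipotent ↥(maximalRealSubfield L) L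 (IsCMField.complexConj L) 3)) : (quasiSplit (↥(maximalRealSubfield L)) L (IsCMField.complexConj L) 3).Adelic) * k) ∂μF)) • fun s => ∏ w, g w s := by
    funext s
    rw [Function.comp_apply, Pi.smul_apply, smul_eq_mul]
    rw [integral_flatSectionU_const_centre_eq_prod_cpow_mul_cm_three L hc hcδ hδ μF φ₀ z' hk ((InfiniteAdeleRing.ringEquiv_mixedSpace L).symm s) B, hP s,
      ofReal_prod_cpow_of_nonneg Finset.univ (fun w _ => (quad_pos (ℓ w s)).le) (1 - 2 * z')]
    simp only [hg_def, Function.comp_apply]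
    ring
  have hcd : ContDiff ℝ m ((((μF (adeleFundamentalDomain ↥(maximalRealSubfield L))).toReal⁻¹ : ℂ) * (∫ t, flatSectionU (fun _ : (quasiSplit (↥(maximalRealSubfield L)) L (IsCMField.complexConj L) 3).Adelic => φ₀) z' (((quasiSplit (↥(maximalRealSubfield L)) L (IsCMField.complexConj L) 3).toAdelic (weylLongU ((IsCMField.complexConj L : L ≃ₐ[↥(maximalRealSubfield L)] L) : L →+* L) (rfl : ((StdForm.antidiagonal 3).over L) = ((StdForm.antidiagonal 3).over L)))) * ((heisChart hc ((((0 : InfiniteAdeleRing L), B) : AdeleRing (𝓞 L) L), traceZeroLine ↥(maximalRealSubfield L) L (IsCMField.complexConj L) hcδ hδ t) : ↥(adelicUnipotent ↥(maximalRealSubfield L) L (IsCMField.complexConj L) 3)) : (quasiSplit (↥(maximalRealSubfield L)) L (IsCMField.complexConj L) 3).Adelic) * k) ∂μF)) • fun s => ∏ w, g w s) := hprod.const_smul (((μF (adeleFundamentalDomain ↥(maximalRealSubfield L))).toReal⁻¹ : ℂ) * (∫ t, flatSectionU (fun _ : (quasiSplit (↥(maximalRealSubfield L)) L (IsCMField.complexConj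 L) 3).Adelic => φ₀) z' (((quasiSplit (↥(maximalRealSubfield L)) L (IsCMField.complexConj L) 3).toAdelic (weylLongU ((IsCMField.complexConj L : L ≃ₐ[↥(maximalRealSubfield L)] L) : L →+* L) (rfl : ((StdForm.antidiagonal 3).over L) = ((StdForm.antidiagonal 3).over L)))) * ((heisChart hc ((((0 : InfiniteAdeleRing L), B) : AdeleRing (𝓞 L) L), traceZeroLine ↥(maximalRealSubfield L) L (IsCMField.complexConj L) hcδ hδ t) : ↥(adelicUnipotent ↥(maximalRealSubfield L) L (IsCMField.complexConj L) 3)) : (quasiSplit (↥(maximalRealSubfield L)) L (IsCMField.complexConj L) 3).Adelic) * k) ∂μF))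
  refine ⟨by rw [hfun]; exact hcd, fun j hj s => ?_⟩
  rw [hfun, iteratedFDeriv_const_smul_apply ((hprod.of_le (by exact_mod_cast hj)).contDiffAt), _root_.norm_smul]
  -- (4) the right-hand side by the real twin of ★ (E-c): `∫ C_φ·H(…(ι⁻¹s,B)…)^{Re z′} = (∏_w q(s_w))^{1−2Re z′} · (C_φ · J₀)`
  rw [integral_sphericalCentreLine_rpow_eq_prod_rpow_mul_cm_three L hc hcδ hδ μF (‖((μF (adeleFundamentalDomain ↥(maximalRealSubfield L))).toReal⁻¹ : ℂ)‖ * ‖φ₀‖ * (2 ^ m * Cmax) ^ (Finset.univ : Finset (InfinitePlace L)).card) z'.re hk ((InfiniteAdeleRing.ringEquiv_mixedSpace L).symm s) B,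
    integral_const_mul, hP s]
  -- (5) `‖c_D·I₀‖·(2^m C_max)^# · ∏_w e_w ≤ (∏_w q_w)^{1−2Re z′} · C_φ · J₀`
  have hE : ∏ w, e w s = (∏ w : InfinitePlace L, (1 + ‖ℓ w s‖ ^ 2 / 2)) ^ (1 - 2 * z'.re) := Real.finsetProd_rpow Finset.univ (fun w => 1 + ‖ℓ w s‖ ^ 2 / 2) (fun w _ => (quad_pos (ℓ w s)).le) _
  have hJ0 : 0 ≤ (∫ t, ((borelHeight (((quasiSplit (↥(maximalRealSubfield L)) L (IsCMField.complexConj L) 3).toAdelic (weylLongU ((IsCMField.complexConj L : L ≃ₐ[↥(maximalRealSubfield L)] L) : L →+* L) (rfl : ((StdForm.antidiagonal 3).over L) = ((StdForm.antidiagonal 3).over L)))) * ((heisChart hc ((((0 : InfiniteAdeleRing L), B) : AdeleRing (𝓞 L) L), traceZeroLine ↥(maximalRealSubfield L) L (IsCMField.complexConj L) hcδ hδ t) : ↥(adelicUnipotent ↥(maximalRealSubfield L) L (IsCMField.complexConj L) 3)) : (quasiSplit (↥(maximalRealSubfield L)) L (IsCMField.complexConj L) 3).Adelic) * k) : ℝ))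 ^ z'.re ∂μF) := integral_nonneg fun t => Real.rpow_nonneg (NNReal.coe_nonneg _) _
  have hI0 : ‖(∫ t, flatSectionU (fun _ : (quasiSplit (↥(maximalRealSubfield L)) L (IsCMField.complexConj L) 3).Adelic => φ₀) z' (((quasiSplit (↥(maximalRealSubfield L)) L (IsCMField.complexConj L) 3).toAdelic (weylLongU ((IsCMField.complexConj L : L ≃ₐ[↥(maximalRealSubfield L)] L) : L →+* L) (rfl : ((StdForm.antidiagonal 3).over L) = ((StdForm.antidiagonal 3).over L)))) * ((heisChart hc ((((0 : InfiniteAdeleRing L), B) : AdeleRing (𝓞 L) L), traceZeroLine ↥(maximalRealSubfield L) L (IsCMField.complexConj L) hcδ hδ t) : ↥(adelicUnipotent ↥(maximalRealSubfield L) L (IsCMField.complexConj L) 3)) : (quasiSplit (↥(maximalRealSubfield L)) L (IsCMField.complexConj L) 3).Adelic) * k) ∂μF)‖ ≤ ‖φ₀‖ * (∫ t, ((borelHeight (((quasiSplit (↥(maximalRealSubfield L)) L (IsCMField.complexConj L) 3).toAdelic (weylLongU ((IsCMField.complexConj L : L ≃ₐ[↥(maximalRealSubfield L)] L) : L →+*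 L) (rfl : ((StdForm.antidiagonal 3).over L) = ((StdForm.antidiagonal 3).over L)))) * ((heisChart hc ((((0 : InfiniteAdeleRing L), B) : AdeleRing (𝓞 L) L), traceZeroLine ↥(maximalRealSubfield L) L (IsCMField.complexConj L) hcδ hδ t) : ↥(adelicUnipotent ↥(maximalRealSubfield L) L (IsCMField.complexConj L) 3)) : (quasiSplit (↥(maximalRealSubfield L)) L (IsCMField.complexConj L) 3).Adelic) * k) : ℝ)) ^ z'.re ∂μF) := norm_integral_flatSectionU_const_le μF φ₀ z' _
  have hPpos : 0 ≤ (∏ w : InfinitePlace L, (1 + ‖ℓ w s‖ ^ 2 / 2)) ^ (1 - 2 * z'.re) := Real.rpow_nonneg (Finset.prod_nonneg fun w _ => (quad_pos (ℓ w s)).le) _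
  calc ‖((μF (adeleFundamentalDomain ↥(maximalRealSubfield L))).toReal⁻¹ : ℂ) * (∫ t, flatSectionU (fun _ : (quasiSplit (↥(maximalRealSubfield L)) L (IsCMField.complexConj L) 3).Adelic => φ₀) z' (((quasiSplit (↥(maximalRealSubfield L)) L (IsCMField.complexConj L) 3).toAdelic (weylLongU ((IsCMField.complexConj L : L ≃ₐ[↥(maximalRealSubfield L)] L) : L →+* L) (rfl : ((StdForm.antidiagonal 3).over L) = ((StdForm.antidiagonal 3).over L)))) * ((heisChart hc ((((0 : InfiniteAdeleRing L), B) : AdeleRing (𝓞 L) L), traceZeroLine ↥(maximalRealSubfield L) L (IsCMField.complexConj L) hcδ hδ t) : ↥(adelicUnipotent ↥(maximalRealSubfield L) L (IsCMField.complexConj L) 3)) : (quasiSplit (↥(maximalRealSubfield L)) L (IsCMField.complexConj L) 3).Adelic) * k) ∂μF)‖ * ‖iteratedFDeriv ℝ j (fun s => ∏ w, g w s) s‖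
      ≤ ‖((μF (adeleFundamentalDomain ↥(maximalRealSubfield L))).toReal⁻¹ : ℂ) * (∫ t, flatSectionU (fun _ : (quasiSplit (↥(maximalRealSubfield L)) L (IsCMField.complexConj L) 3).Adelic => φ₀) z' (((quasiSplit (↥(maximalRealSubfield L)) L (IsCMField.complexConj L) 3).toAdelic (weylLongU ((IsCMField.complexConj L : L ≃ₐ[↥(maximalRealSubfield L)] L) : L →+* L) (rfl : ((StdForm.antidiagonal 3).over L) = ((StdForm.antidiagonal 3).over L)))) * ((heisChart hc ((((0 : InfiniteAdeleRing L), B) : AdeleRing (𝓞 L) L), traceZeroLine ↥(maximalRealSubfield L) L (IsCMField.complexConj L) hcδ hδ t) : ↥(adelicUnipotent ↥(maximalRealSubfield L) L (IsCMField.complexConj L) 3)) : (quasiSplit (↥(maximalRealSubfield L)) L (IsCMField.complexConj L) 3).Adelic) * k) ∂μF)‖ * ((2 ^ m * Cmax) ^ (Finset.univ : Finset (InfinitePlace L)).card * ∏ w, e w s) := mul_le_mul_of_nonneg_left (hbound j hj s) (norm_nonneg _)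
    _ = ‖((μF (adeleFundamentalDomain ↥(maximalRealSubfield L))).toReal⁻¹ : ℂ)‖ * ‖(∫ t, flatSectionU (fun _ : (quasiSplit (↥(maximalRealSubfield L)) L (IsCMField.complexConj L) 3).Adelic => φ₀) z' (((quasiSplit (↥(maximalRealSubfield L)) L (IsCMField.complexConj L) 3).toAdelic (weylLongU ((IsCMField.complexConj L : L ≃ₐ[↥(maximalRealSubfield L)] L) : L →+* L) (rfl : ((StdForm.antidiagonal 3).over L) = ((StdForm.antidiagonal 3).over L)))) * ((heisChart hc ((((0 : InfiniteAdeleRing L), B) : AdeleRing (𝓞 L) L), traceZeroLine ↥(maximalRealSubfield L) L (IsCMField.complexConj L) hcδ hδ t) : ↥(adelicUnipotent ↥(maximalRealSubfield L) L (IsCMField.complexConj L) 3)) : (quasiSplit (↥(maximalRealSubfield L)) L (IsCMField.complexConj L) 3).Adelic) * k) ∂μF)‖ * (2 ^ m * Cmax) ^ (Finset.univ : Finset (InfinitePlace L)).card * (∏ w : InfinitePlace L, (1 + ‖ℓ w s‖ ^ 2 / 2)) ^ (1 - 2 * z'.re) := by rw [norm_mul, hE]; ring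
    _ ≤ ‖((μF (adeleFundamentalDomain ↥(maximalRealSubfield L))).toReal⁻¹ : ℂ)‖ * (‖φ₀‖ * (∫ t, ((borelHeight (((quasiSplit (↥(maximalRealSubfield L)) L (IsCMField.complexConj L) 3).toAdelic (weylLongU ((IsCMField.complexConj L : L ≃ₐ[↥(maximalRealSubfield L)] L) : L →+* L) (rfl : ((StdForm.antidiagonal 3).over L) = ((StdForm.antidiagonal 3).over L)))) * ((heisChart hc ((((0 : InfiniteAdeleRing L), B) : AdeleRing (𝓞 L) L), traceZeroLine ↥(maximalRealSubfield L) L (IsCMField.complexConj L) hcδ hδ t) : ↥(adelicUnipotent ↥(maximalRealSubfield L) L (IsCMField.complexConj L) 3)) : (quasiSplit (↥(maximalRealSubfield L)) L (IsCMField.complexConj L) 3).Adelic) * k) : ℝ)) ^ z'.re ∂μF)) * (2 ^ m * Cmax) ^ (Finset.univ : Finset (InfinitePlace L)).card * (∏ w : InfinitePlace L, (1 + ‖ℓ w s‖ ^ 2 / 2)) ^ (1 - 2 * z'.re) :=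
        mul_le_mul_of_nonneg_right (mul_le_mul_of_nonneg_right (mul_le_mul_of_nonneg_left hI0 (norm_nonneg _)) (by positivity)) hPpos
    _ = (∏ w : InfinitePlace L, (1 + ‖ℓ w s‖ ^ 2 / 2)) ^ (1 - 2 * z'.re) * (‖((μF (adeleFundamentalDomain ↥(maximalRealSubfield L))).toReal⁻¹ : ℂ)‖ * ‖φ₀‖ * (2 ^ m * Cmax) ^ (Finset.univ : Finset (InfinitePlace L)).card * (∫ t, ((borelHeight (((quasiSplit (↥(maximalRealSubfield L)) L (IsCMField.complexConj L) 3).toAdelic (weylLongU ((IsCMField.complexConj L : L ≃ₐ[↥(maximalRealSubfield L)] L) : L →+* L) (rfl : ((StdForm.antidiagonal 3).over L) = ((StdForm.antidiagonal 3).over L)))) * ((heisChart hc ((((0 : InfiniteAdeleRing L), B) : AdeleRing (𝓞 L) L), traceZeroLine ↥(maximalRealSubfield L) L (IsCMField.complexConj L) hcδ hδ t) : ↥(adelicUnipotent ↥(maximalRealSubfield L) L (IsCMField.complexConj L) 3)) : (quasiSplit (↥(maximalRealSubfield L)) L (IsCMField.complexConj L) 3).Adelic) * k) : ℝ)) ^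 z'.re ∂μF)) := by ring

end ArchSmoothZ

end Summit.HodgeConjecture.HodgeConjecture.Cruxes.H413.K2E1HeightLineArchSmoothU3E

end
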